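import Mathlib

/-!
# `DivisionGap.PerCofactorDegreeReduction` (stmt-ValiantsHypothesis-15046), line `Sketch_ideator4`
(idea intrinsic-member-descent): the DENSE BLOCK (stub `stub_denseBlock`, Q)

Pure finite combinatorics on the `n × n` board; cells are `(row, col)` and `G` is a set of cells in
which every row and every column has at least `n - t` cells.  If `m (t + 1) + t ≤ n` and
`2 (t + m) ≤ n`, then `G` contains a FULL `m × m` block `er(Fin m) × ec(Fin m)` (`er, ec`
injective) together with an injective matching `j ↦ (M₀ j, j) ∈ G` of the columns `j` off the
range of `ec` into the rows off the range of `er` — exactly the hypotheses of the block projection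
`BlockProjection.stub_blockProjection` (with `A = G`).

Proof.
* Block rows: any `m` rows (`m ≤ n`).
* Block columns: each block row misses at most `t` columns, so the common neighbourhood of the
  `m` block rows has at least `n - m t ≥ m + t ≥ m` columns; take `m` of them.
* Matching, by HALL's theorem (`Fintype.all_card_le_filter_rel_iff_exists_injective`) for the
  relation "`(i, j) ∈ G`, `i` off the block rows" between the columns `j` off the block columns and
  the rows: a set `S` of such columns with `|S| ≤ n - t - m` is dominated by the off-block
  neighbours of any single `j ∈ S` (a column has `≥ n - t` cells, at most `m` of them in block
  rows); if `|S| > n - t - m ≥ t` then EVERY off-block row `i` is a neighbour of `S` (the row `i`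
  misses at most `t < |S|` columns), and there are `n - m ≥ |S|` off-block rows. [folklore]
-/

noncomputable section

-- `Summit.ValiantsHypothesis.ValiantsHypothesis.…` is the tree's mandated single-conjunct layout
-- (Sub = Summit), so the duplicated namespace component is intended.
set_option linter.dupNamespace false

open Finset

namespace Summit.ValiantsHypothesis.ValiantsHypothesis.Theorems.DivisionGap.PerCofactorDegreeReduction.DenseBlock

/-- A line of the `n × n` board with at least `n - t` cells satisfying `P` has at most `t` cells
violating `P`. [folklore] -/
private theorem card_filter_not_le {n t : ℕ} {P : Fin n → Prop} [DecidablePred P]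
    (h : n - t ≤ #(univ.filter P)) : #(univ.filter fun x => ¬ P x) ≤ t := by
  have hsplit := card_filter_add_card_filter_not (s := (univ : Finset (Fin n))) P
  rw [card_univ, Fintype.card_fin] at hsplit
  omega

/-- The rows off the range of an injection `er : Fin m → Fin n` number at least `n - m`.
[folklore] -/
private theorem le_card_off_range {n m : ℕ} (er : Fin m → Fin n) :
    n - m ≤ #(univ.filter fun i => ∀ a, er a ≠ i) := by
  have hsplit := card_filter_add_card_filter_not (s := (univ : Finset (Fin n)))
    (fun i => ∀ a, er a ≠ i)
  rw [card_univ, Fintype.card_fin] at hsplit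
  have hle : #(univ.filter fun i => ¬ ∀ a, er a ≠ i) ≤ m :=
    calc #(univ.filter fun i => ¬ ∀ a, er a ≠ i) ≤ #(univ.image er) := by
          refine card_le_card fun i hi => ?_
          obtain ⟨a, ha⟩ := not_forall.1 (mem_filter.1 hi).2
          exact mem_image.2 ⟨a, mem_univ _, not_not.1 ha⟩
      _ ≤ m := card_image_le.trans (by simp)
  omega

/-- A finset of columns off the range of an injection `ec : Fin m → Fin n` has at most `n - m`
elements. [folklore] -/
private theorem card_le_of_off_range {n m : ℕ} {ec : Fin m → Fin n} (hec : Function.Injective ec)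
    (s : Finset {j : Fin n // ∀ b, ec b ≠ j}) : #s ≤ n - m := by
  have hsub : s.map (Function.Embedding.subtype _) ⊆ univ \ univ.image ec := by
    intro j hj
    obtain ⟨j', -, rfl⟩ := mem_map.1 hj
    rw [mem_sdiff, mem_image]
    exact ⟨mem_univ _, fun ⟨b, _, hb⟩ => j'.2 b hb⟩
  have hcard : #(univ \ univ.image ec) = n - m := by
    rw [card_sdiff_of_subset (subset_univ _), card_univ, Fintype.card_fin,
      card_image_of_injective _ hec, card_univ, Fintype.card_fin]
  calc #s = #(s.map (Function.Embedding.subtype _)) := (card_map _).symm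
    _ ≤ #(univ \ univ.image ec) := card_le_card hsub
    _ = n - m := hcard

/-- **The dense block.**  If every row and every column of `G ⊆ Fin n × Fin n` has at least
`n - t` cells, `m (t + 1) + t ≤ n` and `2 (t + m) ≤ n`, then there are injections
`er, ec : Fin m → Fin n` with the full block `(er a, ec b) ∈ G`, and a map `M₀` sending every
column `j` off the range of `ec` to a row `M₀ j` off the range of `er` with `(M₀ j, j) ∈ G`,
injectively on these columns (block rows: any `m` rows; block columns: `m` common neighbours of
the block rows; matching: Hall's theorem). [folklore] -/
theorem stub_denseBlock :
    ∀ (n t m : ℕ) (G : Finset (Fin n × Fin n)), m * (t + 1) + t ≤ n → 2 * (t + m) ≤ n →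
      (∀ i : Fin n, n - t ≤ (Finset.univ.filter fun j => (i, j) ∈ G).card) →
      (∀ j : Fin n, n - t ≤ (Finset.univ.filter fun i => (i, j) ∈ G).card) →
      ∃ (er ec : Fin m → Fin n) (M₀ : Fin n → Fin n),
        Function.Injective er ∧ Function.Injective ec ∧
        (∀ a b, (er a, ec b) ∈ G) ∧
        (∀ j, (∀ b, ec b ≠ j) → (M₀ j, j) ∈ G ∧ ∀ a, er a ≠ M₀ j) ∧
        (∀ j j', (∀ b, ec b ≠ j) → (∀ b, ec b ≠ j') → M₀ j = M₀ j' → j = j') := by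
  intro n t m G hmt h2 hrow hcol
  classical
  have hmt' : m * t + m + t ≤ n := by
    have := mul_add_one m t
    omega
  have hmn : m ≤ n := by omega
  /- Step 1: the block rows, any injection `Fin m → Fin n`. -/
  obtain ⟨er, her⟩ : ∃ er : Fin m → Fin n, Function.Injective er :=
    ⟨Fin.castLE hmn, Fin.castLE_injective hmn⟩
  /- Step 2: the block columns, `m` common `G`-neighbours of the block rows. -/
  obtain ⟨ec, hec, hblock⟩ :
      ∃ ec : Fin m → Fin n, Function.Injective ec ∧ ∀ a b, (er a, ec b) ∈ G := by
    -- the common neighbourhood `Cm` of the block rows has at least `m` columns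
    obtain ⟨Cm, hCm_spec, hCm⟩ :
        ∃ Cm : Finset (Fin n), (∀ j ∈ Cm, ∀ a, (er a, j) ∈ G) ∧ m ≤ #Cm := by
      refine ⟨univ.filter fun j => ∀ a : Fin m, (er a, j) ∈ G, fun j hj => (mem_filter.1 hj).2,
        ?_⟩
      -- its complement lies in the union of the (at most `t`) missed columns of the block rows
      have hcompl : #(univ.filter fun j => ¬ ∀ a : Fin m, (er a, j) ∈ G) ≤ m * t :=
        calc #(univ.filter fun j => ¬ ∀ a : Fin m, (er a, j) ∈ G)
            ≤ #((univ : Finset (Fin m)).biUnion fun a => univ.filter fun j => (er a, j) ∉ G) := by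
              refine card_le_card fun j hj => ?_
              obtain ⟨a, ha⟩ := not_forall.1 (mem_filter.1 hj).2
              exact mem_biUnion.2 ⟨a, mem_univ _, mem_filter.2 ⟨mem_univ _, ha⟩⟩
          _ ≤ ∑ a, #(univ.filter fun j => (er a, j) ∉ G) := card_biUnion_le
          _ ≤ ∑ _a : Fin m, t := sum_le_sum fun a _ => card_filter_not_le (hrow (er a))
          _ = m * t := by simp
      have hsplit := card_filter_add_card_filter_not (s := (univ : Finset (Fin n)))
        (fun j => ∀ a : Fin m, (er a, j) ∈ G)
      rw [card_univ, Fintype.card_fin] at hsplit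
      omega
    refine ⟨fun b => Cm.orderEmbOfFin rfl (Fin.castLE hCm b),
      fun b b' h => Fin.castLE_injective hCm ((Cm.orderEmbOfFin rfl).injective h),
      fun a b => hCm_spec _ (Cm.orderEmbOfFin_mem rfl _) a⟩
  /- Step 3: the matching of the columns off the range of `ec` into the rows off the range of
  `er`, by Hall's theorem. -/
  obtain ⟨f, hf, hfmem⟩ : ∃ f : {j : Fin n // ∀ b, ec b ≠ j} → Fin n,
      Function.Injective f ∧ ∀ j, (f j, (j : Fin n)) ∈ G ∧ ∀ a, er a ≠ f j := by
    refine (Fintype.all_card_le_filter_rel_iff_exists_injective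
      fun (j : {j : Fin n // ∀ b, ec b ≠ j}) (i : Fin n) => (i, (j : Fin n)) ∈ G ∧ ∀ a, er a ≠ i).1
      fun s => ?_
    rcases s.eq_empty_or_nonempty with rfl | ⟨j₀, hj₀⟩
    · simp
    by_cases hsmall : #s ≤ n - t - m
    · /- small `s`: the off-block `G`-neighbours of the single column `j₀ ∈ s` suffice -/
      calc #s ≤ n - t - m := hsmall
        _ ≤ #(univ.filter fun i => (i, (j₀ : Fin n)) ∈ G) - #(univ.image er) := by
            have h1 := hcol j₀
            have h2 : #(univ.image er) ≤ m := card_image_le.trans (by simp)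
            omega
        _ ≤ #((univ.filter fun i => (i, (j₀ : Fin n)) ∈ G) \ univ.image er) := le_card_sdiff _ _
        _ ≤ #(univ.filter fun i => (i, (j₀ : Fin n)) ∈ G ∧ ∀ a, er a ≠ i) := by
            refine card_le_card fun i hi => ?_
            rw [mem_sdiff, mem_filter, mem_image] at hi
            exact mem_filter.2 ⟨mem_univ _, hi.1.2, fun a ha => hi.2 ⟨a, mem_univ _, ha⟩⟩
        _ ≤ _ := by
            refine card_le_card fun i hi => ?_
            exact mem_filter.2 ⟨mem_univ _, j₀, hj₀, (mem_filter.1 hi).2⟩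
    · /- large `s` (`|s| > n - t - m ≥ t`): every off-block row is a neighbour of `s` -/
      have hbig : n - t - m < #s := not_le.1 hsmall
      calc #s ≤ n - m := card_le_of_off_range hec s
        _ ≤ #(univ.filter fun i => ∀ a, er a ≠ i) := le_card_off_range er
        _ ≤ _ := by
            refine card_le_card fun i hi => ?_
            have hi' : ∀ a, er a ≠ i := (mem_filter.1 hi).2
            refine mem_filter.2 ⟨mem_univ _, ?_⟩
            by_contra hcon
            -- all the columns of `s` would be missed by the row `i`, but `|s| > t`
            have hsub : s.map (Function.Embedding.subtype _) ⊆ univ.filter fun j => (i, j) ∉ G := by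
              intro j hj
              obtain ⟨j', hj', rfl⟩ := mem_map.1 hj
              exact mem_filter.2 ⟨mem_univ _, fun hG => hcon ⟨j', hj', hG, hi'⟩⟩
            have h1 := card_le_card hsub
            rw [card_map] at h1
            have h2 := card_filter_not_le (hrow i)
            omega
  /- Assembly: `M₀` is the Hall matching on the columns off the range of `ec`. -/
  refine ⟨er, ec, fun j => if h : ∀ b, ec b ≠ j then f ⟨j, h⟩ else j, her, hec, hblock,
    fun j hj => ?_, fun j j' hj hj' hM => ?_⟩
  · simp only [dif_pos hj]
    exact hfmem ⟨j, hj⟩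
  · simp only [dif_pos hj, dif_pos hj'] at hM
    exact congrArg Subtype.val (hf hM)

end Summit.ValiantsHypothesis.ValiantsHypothesis.Theorems.DivisionGap.PerCofactorDegreeReduction.DenseBlock

end
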